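import Mathlib
import Summits.QuantumFields.BalabanUV.Beta.UnitLatticeTorusPartition
import Summits.QuantumFields.BalabanUV.Beta.UnitLatticeOmegaBoxTilt

/-!
# `Summit.QuantumFields.BalabanUV.Beta.UnitLatticeOmegaTorus` — THE Ω-LAYER ENDs ON THE TORUS: the torus-periodic twins of
# `UnitLatticeOmegaBox.rowData_decFamilyΩ_box` ∕ `termSum_decFamilyΩ_box_one`, `UnitLatticeOmegaBoxLocal.termSum_box_of_pieceMaj`,
# `UnitLatticeOmegaBoxEnd.termSum_box_end` and `UnitLatticeOmegaBoxTilt.termSum_box_tilt` for unit-lattice sites mapped into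
# the discrete torus `Π_i ℤ∕N_iℤ` (b05's `UT N`), with b05's smooth partition, the torus cells and the torus profiles of
# `UnitLatticeTorusPartition` — SAME hypothesis list as on the box ((i) ONE `pieceMaj` bound, (ii) ONE coercivity datum —
# automatic for the tilt (I4), (iii) row-locality in cells, (iv) the near convention, (v) closed-form numbers) and NO
# «sites inside the box» condition (Σ_b h_b² = 1 holds at every site of the torus)

HONEST FRAMING (page 1 of everything in this cell).  Discharging `FlowStep.BetaPertH` would make Bałaban's ultraviolet
stability UNCONDITIONAL — a constructive-QFT result; NOT the continuum limit, NOT the Clay problem.  This module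
discharges nothing of `BetaPertH`; [folklore] bookkeeping, kernel-checked (unit `b2b-balaban-beta-d4-p3`, road P3, gen 6;
the row-D4 owner's (I3) leaf table NOTE-I3 §3 row (c) «Bałaban's `T_η^{(k)}` is a torus: the periodic twin», the item this
lineage announced at gen 5).  WHY: Bałaban's small-field step lives on the torus `T_η^{(k)}` ([II] p. 3), co-owner d4-p2's
MODEL instance of interface item (I1) (`CovariantTowerRowData.rowData_tower_torus`) lives on b05's `UT N` with the distance
`dTorus` and partition `hTorus` = the objects used here, and the row owner's (I3)∕(I4) sockets
(`AnalyticWalkSum216RowConstrainedDict`, `…RowResolventOmega`) consume this lineage's Ω hand-off — so with this module the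
three meet on ONE carrier.  Nothing of Bałaban's operators is instantiated ((T3) = `hT`, E-I3 = `hRe`, NODE O.2 untouched);
readiness width 0 unchanged; NOT summit progress.
HONEST DEPENDENCY: continuum YM on T⁴ ⇐ BetaPertH ∧ nine spine estimates (0/9 proved); BetaPertH ⇐
(D1) ∧ (D4) ∧ CAP+tail; G-an2-4 gates asym, D1 and NE2/3/4.

CITATION (locator only; nothing printed is used as a hypothesis).  [II] = T. Bałaban, *Renormalization group approach to
lattice gauge field theories. II. Cluster expansions*, Commun. Math. Phys. **116**, 1–22 (1988) [Balaban1988RG2Cluster],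
p. 3 (the torus `T_η`, cubes Δ, monomials in `s(Δ)`), p. 5 (1.11) (`e^{mκ₁}`, `δ₁M ≥ κ₁`, the 2⁴), p. 13 after (2.7) (the
x-tilt), p. 16 (2.16)–(2.17) (x-uniformity); [B5] = T. Bałaban, Commun. Math. Phys. **95**, 17–40 (1984)
[Balaban1984PropagatorsI], (1.118) p. 36 (`Σ_z h_z² = 1` on the torus).

CONTENTS (0 sorry).  §1 `tdomOf` (piece domains read off the cell budgets, torus cells) + membership lemmas.  §2
**`rowData_decFamilyΩ_torus`** (the Ω hand-off on the torus: `UnitLatticeOmegaBudgets.rowData_decFamilyΩ_pieceMaj` with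
`d := tdistOn e`, `h := hTor M₀ e`, `E := ETor M₀ e`, `cellOf := tcellAt M_d e`, `r := D := 2M₀`, `R := 4M₀`, `P := 2^ν`,
`N := 2^ν`, Lipschitz modulus `M₀∕(4ν)` — every geometric binder BY NAME from `UnitLatticeTorusPartition`).  §3
**`termSum_decFamilyΩ_torus_one`** (at `s ≡ 1` the sum is `(1 + Σ_ωK_ω)⁻¹` — for ALL sites, `hTor_sq_sum`).  §4
**`termSum_torus_of_pieceMaj`** (local inverses CONSTRUCTED, `UnitLatticeOmegaLocal.nearLocal_of_pieceMaj`), **`termSum_torus_end`**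
(numbers only, injective sites: the torus profiles plugged in), **`termSum_torus_tilt`** ((I4): the coercivity datum automatic,
x-free hypotheses at level `X`).  §5 non-vacuity on the circle `ℤ∕8`.
NOT HERE: any instance on Bałaban's operators; the (I3) composition with E-I3 (the row owner's
`AnalyticWalkSum216RowConstrainedBoxEnd`, box version).  NOT summit progress.
-/

open scoped BigOperators Matrix
open Finset Matrix Metric Real

namespace Summit.QuantumFields.BalabanUV.Beta.UnitLatticeOmegaTorus

open Summit.QuantumFields.BalabanUV.Beta.UnitLatticeWalkInversion
open Summit.QuantumFields.BalabanUV.Beta.UnitLatticeWalkInversionDecay (locInv)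
open Summit.QuantumFields.BalabanUV.Beta.UnitLatticeTorusPartition
open Summit.QuantumFields.BalabanUV.Beta.UnitLatticeOmegaTerms
open Summit.QuantumFields.BalabanUV.Beta.UnitLatticeOmegaRowData
open Summit.QuantumFields.BalabanUV.Beta.UnitLatticeOmegaCells
open Summit.QuantumFields.BalabanUV.Beta.UnitLatticeOmegaBudgets
open Summit.QuantumFields.BalabanUV.Beta.UnitLatticeOmegaLocal (nearLocal_of_pieceMaj)
open Summit.QuantumFields.BalabanUV.Beta.UnitLatticeOmegaBoxTilt (rowBound_pieceK colBound_pieceK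
  reCoercive_one_add_tilt)
open Summit.QuantumFields.BalabanUV.Beta.AnalyticWalkSum216 (termSum)
open Summit.QuantumFields.BalabanUV.Beta.AnalyticWalkSum216RowData (RowData)
open Summit.QuantumFields.BalabanUV.Beta.AnalyticWalkSum216RowResolvent (pieceMaj pieceK Ktot_pieceK wrs_Rem₂_le)
open Literature.MathematicalPhysics.QuantumFieldTheory.Balaban1983to89
open B13PerturbativeStep (wrs WRS WeightHyp)
open B5TorusCover (UT Ctr ctrU)
open B5Prop11Lower (nsq)

noncomputable section

variable {ν : ℕ} {N : Fin ν → ℕ} [∀ i, NeZero (N i)]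
variable {Y : Type*} [Fintype Y] [DecidableEq Y] {Ω : Type*} [Fintype Ω] [DecidableEq Ω]

/-! ## §1 Piece domains read off the cell budgets (torus cells) -/

/-- The DOMAIN of a piece READ OFF its cell budget: the sites whose torus cell is charged to the piece. [folklore] -/
def tdomOf (Md : ℕ) (e : Y → UT N) (cellsOf : Ω → Finset (Fin ν → ℤ)) (ω : Ω) : Finset Y :=
  Finset.univ.filter fun y => tcellAt Md e y ∈ cellsOf ω

omit [∀ i, NeZero (N i)] [DecidableEq Y] [Fintype Ω] [DecidableEq Ω] in
/-- Membership in `tdomOf`. [folklore] -/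
theorem mem_tdomOf (Md : ℕ) (e : Y → UT N) (cellsOf : Ω → Finset (Fin ν → ℤ)) (ω : Ω) (y : Y) :
    y ∈ tdomOf Md e cellsOf ω ↔ tcellAt Md e y ∈ cellsOf ω := by
  simp [tdomOf]

omit [∀ i, NeZero (N i)] [DecidableEq Y] [Fintype Ω] [DecidableEq Ω] in
/-- **`hcells` holds by construction**: every site of `tdomOf ω` lies in a charged cell. [folklore] -/
theorem tcellAt_mem_of_mem_tdomOf (Md : ℕ) (e : Y → UT N) (cellsOf : Ω → Finset (Fin ν → ℤ)) :
    ∀ ω, ∀ z ∈ tdomOf Md e cellsOf ω, tcellAt Md e z ∈ cellsOf ω :=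
  fun ω z hz => (mem_tdomOf Md e cellsOf ω z).1 hz

omit [∀ i, NeZero (N i)] [DecidableEq Y] [Fintype Ω] [DecidableEq Ω] in
/-- **`hK` from row-locality in cells**: if `K_ω(k,l) ≠ 0 → cell(k) ∈ cellsOf ω` then `K_ω` is row-local on `tdomOf ω`.
[folklore] -/
theorem rowLocal_tdomOf (Md : ℕ) (e : Y → UT N) (cellsOf : Ω → Finset (Fin ν → ℤ)) (K : Ω → Matrix Y Y ℂ)
    (hKcells : ∀ ω k l, K ω k l ≠ 0 → tcellAt Md e k ∈ cellsOf ω) :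
    ∀ ω k l, K ω k l ≠ 0 → k ∈ tdomOf Md e cellsOf ω :=
  fun ω k l hk => (mem_tdomOf Md e cellsOf ω k).2 (hKcells ω k l hk)

omit [∀ i, NeZero (N i)] [DecidableEq Y] [Fintype Ω] [DecidableEq Ω] in
/-- Row-locality in cells passes to the scaled tilt pieces `x·(R·G_ω·Rᵀ)`. [folklore] -/
theorem tcells_pieceK (Md : ℕ) (e : Y → UT N) (Rm : Matrix Y Y ℂ) (G : Ω → Matrix Y Y ℂ)
    (cellsOf : Ω → Finset (Fin ν → ℤ)) (hKcells₀ : ∀ ω k l, (Rm * G ω * Rmᵀ) k l ≠ 0 → tcellAt Md e k ∈ cellsOf ω)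
    (x : ℂ) : ∀ ω k l, pieceK Rm Rmᵀ G x ω k l ≠ 0 → tcellAt Md e k ∈ cellsOf ω := fun ω k l hne => by
  refine hKcells₀ ω k l fun h0 => hne ?_
  rw [pieceK, Matrix.smul_apply, h0, smul_zero]

/-! ## §2 The Ω hand-off on the torus -/

section Torus

variable {M₀ Md : ℕ}

/-- The overlap number as a real power. [folklore] -/
theorem card_ETor_filter_le' (hM₀ : 1 ≤ M₀) (hdiv : ∀ i, M₀ ∣ N i) (h2N : ∀ i, 2 * M₀ ≤ N i) (e : Y → UT N) (y : Y) :
    ((Finset.univ.filter fun b : Ctr N M₀ => y ∈ ETor M₀ e b).card : ℝ) ≤ (2 : ℝ) ^ ν := by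
  have h := card_ETor_filter_le hM₀ hdiv h2N e y
  push_cast at h
  exact h

/-- **THE Ω HAND-OFF ON THE TORUS.**  Sites `e : Y → UT N` (any finite `Y`; periods `N_i` with `M₀ ∣ N_i`, `2M₀ ≤ N_i`,
`M_d ∣ N_i`); partition `h_b = hTor M₀ e b` (b05's smooth partition, centres `b : Ctr N M₀`, neighbourhoods `ETor` of radius
`M₀`), cells of side `M_d ≥ 8M₀`, `d = tdistOn e`; pieces `K_ω` with cell budgets `cellsOf ω`, row-local in their cells; near
families with the far convention (threshold `m₀`); near-local inverses `L_b` with budget `C_L` at rate `κ′ = κ + κ₁2^ν∕(2M₀)`; THE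
ONE BOUND `hT` at rate `κ⁺ > κ′` with margin `κ₂ ≥ 0`; smallness `ρ_Ω < 1` (Lipschitz modulus `M₀∕(4ν)`).  THEN the fully
decorated ω-family with the coordinate `Δ₀` free is ROW DATA on `‖σ‖ < e^{κ₁}` at rate `κ` — every geometric binder discharged
BY NAME from `UnitLatticeTorusPartition`. [cite: Balaban1988RG2Cluster, (1.11) p.5] -/
theorem rowData_decFamilyΩ_torus (hν : 0 < ν) (hM₀ : 1 ≤ M₀) (hdiv : ∀ i, M₀ ∣ N i) (h2N : ∀ i, 2 * M₀ ≤ N i)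
    (hMd : 8 * M₀ ≤ Md) (hdivd : ∀ i, Md ∣ N i) (e : Y → UT N)
    {κ κ₁ κ₂ κp ρ m₀ C_L : ℝ} (hκ : 0 ≤ κ) (hκ₁ : 0 ≤ κ₁) (hκ₂ : 0 ≤ κ₂) (hC : 0 ≤ C_L)
    (K : Ω → Matrix Y Y ℂ) (cellsOf : Ω → Finset (Fin ν → ℤ))
    (hKcells : ∀ ω k l, K ω k l ≠ 0 → tcellAt Md e k ∈ cellsOf ω)
    (near : Ctr N M₀ → Finset Ω)
    (hfar : ∀ b ω k l, ω ∉ near b → hTor M₀ e b l ≠ 0 → K ω k l ≠ 0 → m₀ ≤ (cellsOf ω).card)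
    (L : Ctr N M₀ → Matrix Y Y ℂ)
    (hL : ∀ b, WRS (κ + κ₁ * ((2 ^ ν : ℕ) / (2 * (M₀ : ℝ)))) (tdistOn e) (L b) C_L)
    (hκp : κ + κ₁ * ((2 ^ ν : ℕ) / (2 * (M₀ : ℝ))) < κp)
    (hT : ∀ k, ∑ l, (∑ ω, pieceMaj (κ₁ + κ₂) K cellsOf ω k l) * Real.exp (κp * tdistOn e k l) ≤ ρ)
    (hρ : C_L * (2 * (2 : ℝ) ^ ν / ((M₀ : ℝ) / (4 * ν))
        * ((Real.exp 1 * (κp - (κ + κ₁ * ((2 ^ ν : ℕ) / (2 * (M₀ : ℝ))))))⁻¹ * ρ)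
        + (2 : ℝ) ^ ν * Real.exp (-(κ₂ * m₀)) * ρ) < 1)
    (τ : (Fin ν → ℤ) → ℂ) (hτ : ∀ δ, ‖τ δ‖ ≤ Real.exp κ₁) (Δ₀ : Fin ν → ℤ) :
    RowData κ (tdistOn e) (Real.exp κ₁)
      (decFamilyΩ (tcellAt Md e) (ETor M₀ e) (tdomOf Md e cellsOf) (hTor M₀ e) K near L τ Δ₀)
      (decMajΩ (Real.exp (κ₁ * (2 ^ ν : ℕ))) (κ₁ * ((2 ^ ν : ℕ) / (2 * (M₀ : ℝ)))) (tdistOn e)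
        (crCells (2 * (M₀ : ℝ)) (2 ^ ν) cellsOf) (hTor M₀ e) K near L)
      (Real.exp (κ₁ * (2 ^ ν : ℕ)) * ((2 : ℝ) ^ ν * C_L) * (1 - (C_L * (2 * (2 : ℝ) ^ ν / ((M₀ : ℝ) / (4 * ν))
        * ((Real.exp 1 * (κp - (κ + κ₁ * ((2 ^ ν : ℕ) / (2 * (M₀ : ℝ))))))⁻¹ * ρ)
        + (2 : ℝ) ^ ν * Real.exp (-(κ₂ * m₀)) * ρ)))⁻¹) := by
  have hM' : (0 : ℝ) < M₀ := by exact_mod_cast hM₀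
  have hν' : (0 : ℝ) < ν := by exact_mod_cast hν
  have hMeff : (0 : ℝ) < (M₀ : ℝ) / (4 * ν) := by positivity
  have hMd0 : 0 < Md := by omega
  have h2R : 2 * (4 * M₀) ≤ Md := by omega
  have hP : 0 < 2 ^ ν := pow_pos (by norm_num) ν
  exact rowData_decFamilyΩ_pieceMaj (weightHyp_tdistOn e hκ) K (tdomOf Md e cellsOf)
    (rowLocal_tdomOf Md e cellsOf K hKcells) near (hTor M₀ e) (ETor M₀ e) L
    (fun b y hy => hTor_supp hM₀ e b y hy) (fun b y => abs_hTor_le M₀ e b y) hMeff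
    (fun b y y' => hTor_lipschitz' hM₀ hν e b y y') (fun y => card_ETor_filter_le' hM₀ hdiv h2N e y) hC hκ₁
    (r := 2 * (M₀ : ℝ)) (D := 2 * (M₀ : ℝ)) (R := ((4 * M₀ : ℕ) : ℝ)) (by positivity) (by push_cast; linarith)
    (tcellAt Md e) hP (fun a => packing_torus hMd0 hdivd h2R e a) (fun b => diam_ETor_le M₀ e b) cellsOf
    (tcellAt_mem_of_mem_tdomOf Md e cellsOf) hfar hL hκp hκ₂ hT hρ τ hτ Δ₀

/-! ## §3 At `s ≡ 1` on the torus: the sum is `(1 + Σ_ω K_ω)⁻¹` -/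

/-- **THE IDENTIFICATION ON THE TORUS** — for ALL sites (b05's `Σ_b h_b² = 1` holds everywhere on the torus, no box
condition): `κ₁ > 0`, the near-local inverse data `hPL`, `hloc`, and the hypotheses of `rowData_decFamilyΩ_torus`; at
`τ ≡ 1`, `σ = 1` the decorated ω-family SUMS to `(1 + Ktot K)⁻¹`, the remainder smallness being the SAME number `ρ_Ω < 1`.
[cite: Balaban1988RG2Cluster, (1.11) p.5] -/
theorem termSum_decFamilyΩ_torus_one (hν : 0 < ν) (hM₀ : 1 ≤ M₀) (hdiv : ∀ i, M₀ ∣ N i) (h2N : ∀ i, 2 * M₀ ≤ N i)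
    (hMd : 8 * M₀ ≤ Md) (hdivd : ∀ i, Md ∣ N i) (e : Y → UT N)
    {κ κ₁ κ₂ κp ρ m₀ C_L : ℝ} (hκ : 0 ≤ κ) (hκ₁ : 0 < κ₁) (hκ₂ : 0 ≤ κ₂) (hC : 0 ≤ C_L)
    (K : Ω → Matrix Y Y ℂ) (cellsOf : Ω → Finset (Fin ν → ℤ))
    (hKcells : ∀ ω k l, K ω k l ≠ 0 → tcellAt Md e k ∈ cellsOf ω)
    (near : Ctr N M₀ → Finset Ω)
    (hfar : ∀ b ω k l, ω ∉ near b → hTor M₀ e b l ≠ 0 → K ω k l ≠ 0 → m₀ ≤ (cellsOf ω).card)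
    (L : Ctr N M₀ → Matrix Y Y ℂ) (hPL : ∀ b, Pj (ETor M₀ e) b * L b = L b)
    (hloc : ∀ b, Pj (ETor M₀ e) b * (1 + Knear K near b) * Pj (ETor M₀ e) b * L b = Pj (ETor M₀ e) b)
    (hL : ∀ b, WRS (κ + κ₁ * ((2 ^ ν : ℕ) / (2 * (M₀ : ℝ)))) (tdistOn e) (L b) C_L)
    (hκp : κ + κ₁ * ((2 ^ ν : ℕ) / (2 * (M₀ : ℝ))) < κp)
    (hT : ∀ k, ∑ l, (∑ ω, pieceMaj (κ₁ + κ₂) K cellsOf ω k l) * Real.exp (κp * tdistOn e k l) ≤ ρ)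
    (hρ : C_L * (2 * (2 : ℝ) ^ ν / ((M₀ : ℝ) / (4 * ν))
        * ((Real.exp 1 * (κp - (κ + κ₁ * ((2 ^ ν : ℕ) / (2 * (M₀ : ℝ))))))⁻¹ * ρ)
        + (2 : ℝ) ^ ν * Real.exp (-(κ₂ * m₀)) * ρ) < 1) (Δ₀ : Fin ν → ℤ) :
    termSum (decFamilyΩ (tcellAt Md e) (ETor M₀ e) (tdomOf Md e cellsOf) (hTor M₀ e) K near L
      (fun _ => (1 : ℂ)) Δ₀) 1 = (1 + Ktot K)⁻¹ := by
  have hM' : (0 : ℝ) < M₀ := by exact_mod_cast hM₀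
  have hν' : (0 : ℝ) < ν := by exact_mod_cast hν
  have hMeff : (0 : ℝ) < (M₀ : ℝ) / (4 * ν) := by positivity
  have hP : 0 < 2 ^ ν := pow_pos (by norm_num) ν
  have hw := weightHyp_tdistOn e hκ
  have hδ : 0 ≤ κ₁ * ((2 ^ ν : ℕ) / (2 * (M₀ : ℝ))) := by positivity
  have hr : (2 * (M₀ : ℝ)) ≠ 0 := by positivity
  have hcr : ∀ ω, κ₁ * ((2 ^ ν : ℕ) / (2 * (M₀ : ℝ))) * crCells (2 * (M₀ : ℝ)) (2 ^ ν) cellsOf ω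
      ≤ κ₁ * ((cellsOf ω).card : ℝ) := fun ω => rate_crCells_le hr hP cellsOf ω
  have hτ : ∀ δ : Fin ν → ℤ, ‖(fun _ => (1 : ℂ)) δ‖ ≤ Real.exp κ₁ := fun _ => by
    rw [norm_one]; exact Real.one_le_exp hκ₁.le
  have h1 : (1 : ℂ) ∈ ball (0 : ℂ) (Real.exp κ₁) := by
    rw [mem_ball_zero_iff, norm_one]; exact Real.one_lt_exp_iff.2 hκ₁
  -- the row data (§2) and the resummation identity with `Σ_b h_b² = 1` at every site of the torus
  have hRD := rowData_decFamilyΩ_torus hν hM₀ hdiv h2N hMd hdivd e hκ hκ₁.le hκ₂ hC K cellsOf hKcells near hfar L hL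
    hκp hT hρ (fun _ => (1 : ℂ)) hτ Δ₀
  have hid := resummation_identity₂ K near (hTor M₀ e) (ETor M₀ e) L (hTor_sq_sum hM₀ hdiv h2N e)
    (fun b y hy => hTor_supp hM₀ e b y hy) hPL hloc
  -- the remainder smallness is the same number (budgets from the ONE bound)
  have hK1 := budgetK₁_of_pieceMaj (d := tdistOn e) hκp (le_add_of_nonneg_right hκ₂) K cellsOf
    (crCells (2 * (M₀ : ℝ)) (2 ^ ν) cellsOf) hcr hT
  have hPhi := budgetΦ_of_pieceMaj hw.nonneg hκp.le hκ₂ K cellsOf (crCells (2 * (M₀ : ℝ)) (2 ^ ν) cellsOf) hcr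
    (hTor M₀ e) (ETor M₀ e) (fun b y hy => hTor_supp hM₀ e b y hy) (fun b y => abs_hTor_le M₀ e b y)
    (fun y => card_ETor_filter_le' hM₀ hdiv h2N e y) near hfar hT
  have hRem := wrs_Rem₂_le hw hδ (crCells (2 * (M₀ : ℝ)) (2 ^ ν) cellsOf)
    (fun ω => crCells_nonneg' (by positivity) (2 ^ ν) cellsOf ω) K near (hTor M₀ e) (ETor M₀ e) L
    (fun b y hy => hTor_supp hM₀ e b y hy) (fun b y => abs_hTor_le M₀ e b y) hMeff
    (fun b y y' => hTor_lipschitz' hM₀ hν e b y y') (fun y => card_ETor_filter_le' hM₀ hdiv h2N e y) hC hL hK1 hPhi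
  exact termSum_decFamilyΩ_one hw hid hRem hρ (tcellAt Md e) (ETor M₀ e) (tdomOf Md e cellsOf) Δ₀ hRD h1

/-! ## §4 The ENDs on the torus: local inverses constructed; numbers only; the x-tilt -/

/-- **THE Ω HAND-OFF ON THE TORUS, LOCAL INVERSES CONSTRUCTED.**  As `UnitLatticeOmegaBoxLocal.termSum_box_of_pieceMaj` with
the torus data: local inverses `L_b := locInv (Knear K near b) (ETor M₀ e) b` (accretive Combes–Thomas on the compressed near
kernel; `UnitLatticeOmegaLocal.nearLocal_of_pieceMaj` BY NAME — `tdistOn e` is symmetric).  INPUTS OF SUBSTANCE: the ONE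
bound (`hT` rows, `hTc` columns), the ONE datum `hRe`, the profiles `L₁`, `L` and the located numeric inequalities.
[cite: Balaban1988RG2Cluster, p.13 after (2.7)] -/
theorem termSum_torus_of_pieceMaj (hν : 0 < ν) (hM₀ : 1 ≤ M₀) (hdiv : ∀ i, M₀ ∣ N i) (h2N : ∀ i, 2 * M₀ ≤ N i)
    (hMd : 8 * M₀ ≤ Md) (hdivd : ∀ i, Md ∣ N i) (e : Y → UT N)
    {κ κ₁ κ₂ κp ρ ρc m₀ γ κc L₁ L : ℝ} (hκ : 0 ≤ κ) (hκ₁ : 0 < κ₁) (hκ₂ : 0 ≤ κ₂)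
    (K : Ω → Matrix Y Y ℂ) (cellsOf : Ω → Finset (Fin ν → ℤ))
    (hKcells : ∀ ω k l, K ω k l ≠ 0 → tcellAt Md e k ∈ cellsOf ω)
    (near : Ctr N M₀ → Finset Ω) (hnear : ∀ b ω, ω ∉ near b → m₀ ≤ (cellsOf ω).card)
    (hκp : κ + κ₁ * ((2 ^ ν : ℕ) / (2 * (M₀ : ℝ))) < κp)
    (hT : ∀ k, ∑ l, (∑ ω, pieceMaj (κ₁ + κ₂) K cellsOf ω k l) * Real.exp (κp * tdistOn e k l) ≤ ρ)
    (hTc : ∀ l, ∑ k, (∑ ω, pieceMaj (κ₁ + κ₂) K cellsOf ω k l) * Real.exp (κp * tdistOn e k l) ≤ ρc)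
    (hRe : ∀ z : Y → ℂ, γ * nsq z ≤ (star z ⬝ᵥ ((1 + Ktot K) *ᵥ z)).re) (hκc : 0 ≤ κc)
    (hL₁ : ∀ i, ∑ j, tdistOn e i j * Real.exp (-((κp - κc) * tdistOn e i j)) ≤ L₁)
    (hL : ∀ i, ∑ j, Real.exp (-((κc - (κ + κ₁ * ((2 ^ ν : ℕ) / (2 * (M₀ : ℝ))))) * tdistOn e i j)) ≤ L)
    (hL0 : 0 ≤ L) (hm : κc * ρ * L₁ < γ - Real.exp (-((κ₁ + κ₂) * m₀)) * (ρ + ρc) / 2)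
    (hρ : (γ - Real.exp (-((κ₁ + κ₂) * m₀)) * (ρ + ρc) / 2 - κc * ρ * L₁)⁻¹ * L
        * (2 * (2 : ℝ) ^ ν / ((M₀ : ℝ) / (4 * ν))
          * ((Real.exp 1 * (κp - (κ + κ₁ * ((2 ^ ν : ℕ) / (2 * (M₀ : ℝ))))))⁻¹ * ρ)
          + (2 : ℝ) ^ ν * Real.exp (-(κ₂ * m₀)) * ρ) < 1) (Δ₀ : Fin ν → ℤ) :
    termSum (decFamilyΩ (tcellAt Md e) (ETor M₀ e) (tdomOf Md e cellsOf) (hTor M₀ e) K near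
      (fun b => locInv (Knear K near b) (ETor M₀ e) b) (fun _ => (1 : ℂ)) Δ₀) 1 = (1 + Ktot K)⁻¹ := by
  have hw := weightHyp_tdistOn e hκ
  have hκ'0 : 0 ≤ κ + κ₁ * ((2 ^ ν : ℕ) / (2 * (M₀ : ℝ))) := by positivity
  have hκp0 : 0 ≤ κp := hκ'0.trans hκp.le
  have hw0 : 0 ≤ κ₁ + κ₂ := add_nonneg hκ₁.le hκ₂
  -- the three local-inverse inputs from ONE bound + ONE datum
  obtain ⟨hPL, hloc, hLb⟩ := nearLocal_of_pieceMaj hw (tdistOn_comm e) K cellsOf near (ETor M₀ e) hw0 hκp0 hnear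
    hT hTc hRe hκc hL₁ hL hL0 hm
  have hC : 0 ≤ (γ - Real.exp (-((κ₁ + κ₂) * m₀)) * (ρ + ρc) / 2 - κc * ρ * L₁)⁻¹ * L :=
    mul_nonneg (inv_nonneg.2 (by linarith)) hL0
  exact termSum_decFamilyΩ_torus_one hν hM₀ hdiv h2N hMd hdivd e hκ hκ₁ hκ₂ hC K cellsOf hKcells near
    (fun b ω k l hω _ _ => hnear b ω hω) (fun b => locInv (Knear K near b) (ETor M₀ e) b) hPL hloc hLb hκp hT hρ Δ₀

/-- **THE END ON THE TORUS, NUMBERS ONLY.**  As `termSum_torus_of_pieceMaj`, for INJECTIVE sites `e`, with the torus profiles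
`L := L⋆(κ_c − κ′)`, `L₁ := L₁⋆(κ⁺ − κ_c)` of `UnitLatticeTorusPartition` plugged in — the same closed forms as the box END
`UnitLatticeOmegaBoxEnd.termSum_box_end` (with the Lipschitz modulus `M₀∕(4ν)` of b05's partition in place of `2M∕(νπ)`).
Hypotheses of substance: (i) `hT`∕`hTc` (the ONE bound = (T3) over NODE O.2), (ii) `hRe` (the ONE datum; E-I3 for (I3), automatic
for (I4)), (iii) `hKcells`, (iv) `hnear`, (v) numbers. [cite: Balaban1988RG2Cluster, p.13 after (2.7)] -/
theorem termSum_torus_end (hν : 0 < ν) (hM₀ : 1 ≤ M₀) (hdiv : ∀ i, M₀ ∣ N i) (h2N : ∀ i, 2 * M₀ ≤ N i)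
    (hMd : 8 * M₀ ≤ Md) (hdivd : ∀ i, Md ∣ N i) (e : Y → UT N) (he : Function.Injective e)
    {κ κ₁ κ₂ κp ρ ρc m₀ γ κc : ℝ} (hκ : 0 ≤ κ) (hκ₁ : 0 < κ₁) (hκ₂ : 0 ≤ κ₂)
    (K : Ω → Matrix Y Y ℂ) (cellsOf : Ω → Finset (Fin ν → ℤ))
    (hKcells : ∀ ω k l, K ω k l ≠ 0 → tcellAt Md e k ∈ cellsOf ω)
    (near : Ctr N M₀ → Finset Ω) (hnear : ∀ b ω, ω ∉ near b → m₀ ≤ (cellsOf ω).card)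
    (hκc : κ + κ₁ * ((2 ^ ν : ℕ) / (2 * (M₀ : ℝ))) < κc) (hκcp : κc < κp)
    (hT : ∀ k, ∑ l, (∑ ω, pieceMaj (κ₁ + κ₂) K cellsOf ω k l) * Real.exp (κp * tdistOn e k l) ≤ ρ)
    (hTc : ∀ l, ∑ k, (∑ ω, pieceMaj (κ₁ + κ₂) K cellsOf ω k l) * Real.exp (κp * tdistOn e k l) ≤ ρc)
    (hRe : ∀ z : Y → ℂ, γ * nsq z ≤ (star z ⬝ᵥ ((1 + Ktot K) *ᵥ z)).re)
    (hm : κc * ρ * ((Real.exp 1 * ((κp - κc) / 2))⁻¹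
          * (2 * (1 - Real.exp (-((κp - κc - (κp - κc) / 2) / ν)))⁻¹) ^ ν)
        < γ - Real.exp (-((κ₁ + κ₂) * m₀)) * (ρ + ρc) / 2)
    (hρ : (γ - Real.exp (-((κ₁ + κ₂) * m₀)) * (ρ + ρc) / 2
          - κc * ρ * ((Real.exp 1 * ((κp - κc) / 2))⁻¹
            * (2 * (1 - Real.exp (-((κp - κc - (κp - κc) / 2) / ν)))⁻¹) ^ ν))⁻¹
        * (2 * (1 - Real.exp (-((κc - (κ + κ₁ * ((2 ^ ν : ℕ) / (2 * (M₀ : ℝ))))) / ν)))⁻¹) ^ ν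
        * (2 * (2 : ℝ) ^ ν / ((M₀ : ℝ) / (4 * ν))
          * ((Real.exp 1 * (κp - (κ + κ₁ * ((2 ^ ν : ℕ) / (2 * (M₀ : ℝ))))))⁻¹ * ρ)
          + (2 : ℝ) ^ ν * Real.exp (-(κ₂ * m₀)) * ρ) < 1) (Δ₀ : Fin ν → ℤ) :
    termSum (decFamilyΩ (tcellAt Md e) (ETor M₀ e) (tdomOf Md e cellsOf) (hTor M₀ e) K near
      (fun b => locInv (Knear K near b) (ETor M₀ e) b) (fun _ => (1 : ℂ)) Δ₀) 1 = (1 + Ktot K)⁻¹ := by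
  have hb : 0 < (κp - κc) / 2 := by linarith
  have hab : (κp - κc) / 2 < κp - κc := by linarith
  have hL0 : (0 : ℝ) ≤ (2 * (1 - Real.exp (-((κc - (κ + κ₁ * ((2 ^ ν : ℕ) / (2 * (M₀ : ℝ))))) / ν)))⁻¹) ^ ν := by
    refine pow_nonneg (mul_nonneg zero_le_two (inv_nonneg.2 (sub_nonneg.2 ?_))) ν
    refine Real.exp_le_one_iff.2 (neg_nonpos.2 (div_nonneg (by linarith) (Nat.cast_nonneg ν)))
  have hκ'0 : 0 ≤ κ + κ₁ * ((2 ^ ν : ℕ) / (2 * (M₀ : ℝ))) := by positivity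
  exact termSum_torus_of_pieceMaj hν hM₀ hdiv h2N hMd hdivd e hκ hκ₁ hκ₂ K cellsOf hKcells near hnear (hκc.trans hκcp)
    hT hTc hRe (hκ'0.trans hκc.le) (fun i => tprofile_one_le e he hb hab i)
    (fun i => tprofile_zero_le e he (sub_pos.2 hκc) i) hL0 hm hρ Δ₀

/-- **THE x-TILT LAYER ON THE TORUS, EVERY `x ∈ [0, X]`, x-FREE HYPOTHESES** (interface item (I4)).  As
`UnitLatticeOmegaBoxTilt.termSum_box_tilt` with the torus data: the pieces `pieceK R Rᵀ G x = x·(R·G_ω·Rᵀ)`, the ONE bound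
assumed for the UNSCALED pieces (`hT₀`, `hTc₀`), the coercivity datum REPLACED by «`R` real, `Σ_ω G_ω` Re-psd» (γ = 1
automatic, `reCoercive_one_add_tilt`), and the numeric inequalities at `ρ := X·ρ₀`, `ρ_c := X·ρc₀`, `γ := 1` — level `X` once,
every `x ≤ X` served ([II] p. 16; R25).  Value at `s ≡ 1`: `(1 + x·R·(Σ_ωG_ω)·Rᵀ)⁻¹`. [cite: Balaban1988RG2Cluster, p.13 after (2.7)] -/
theorem termSum_torus_tilt (hν : 0 < ν) (hM₀ : 1 ≤ M₀) (hdiv : ∀ i, M₀ ∣ N i) (h2N : ∀ i, 2 * M₀ ≤ N i)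
    (hMd : 8 * M₀ ≤ Md) (hdivd : ∀ i, Md ∣ N i) (e : Y → UT N) (he : Function.Injective e)
    {κ κ₁ κ₂ κp ρ₀ ρc₀ m₀ κc X : ℝ} (hκ : 0 ≤ κ) (hκ₁ : 0 < κ₁) (hκ₂ : 0 ≤ κ₂)
    (Rm : Matrix Y Y ℂ) (hR : ∀ i j, (starRingEnd ℂ) (Rm i j) = Rm i j) (G : Ω → Matrix Y Y ℂ)
    (hpsd : ∀ g : Y → ℂ, 0 ≤ (star g ⬝ᵥ (Ktot G *ᵥ g)).re) (cellsOf : Ω → Finset (Fin ν → ℤ))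
    (hKcells₀ : ∀ ω k l, (Rm * G ω * Rmᵀ) k l ≠ 0 → tcellAt Md e k ∈ cellsOf ω)
    (near : Ctr N M₀ → Finset Ω) (hnear : ∀ b ω, ω ∉ near b → m₀ ≤ (cellsOf ω).card)
    (hκc : κ + κ₁ * ((2 ^ ν : ℕ) / (2 * (M₀ : ℝ))) < κc) (hκcp : κc < κp)
    (hT₀ : ∀ k, ∑ l, (∑ ω, pieceMaj (κ₁ + κ₂) (fun ω => Rm * G ω * Rmᵀ) cellsOf ω k l)
      * Real.exp (κp * tdistOn e k l) ≤ ρ₀)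
    (hTc₀ : ∀ l, ∑ k, (∑ ω, pieceMaj (κ₁ + κ₂) (fun ω => Rm * G ω * Rmᵀ) cellsOf ω k l)
      * Real.exp (κp * tdistOn e k l) ≤ ρc₀)
    (hm : κc * (X * ρ₀) * ((Real.exp 1 * ((κp - κc) / 2))⁻¹
          * (2 * (1 - Real.exp (-((κp - κc - (κp - κc) / 2) / ν)))⁻¹) ^ ν)
        < 1 - Real.exp (-((κ₁ + κ₂) * m₀)) * (X * ρ₀ + X * ρc₀) / 2)
    (hρ : (1 - Real.exp (-((κ₁ + κ₂) * m₀)) * (X * ρ₀ + X * ρc₀) / 2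
          - κc * (X * ρ₀) * ((Real.exp 1 * ((κp - κc) / 2))⁻¹
            * (2 * (1 - Real.exp (-((κp - κc - (κp - κc) / 2) / ν)))⁻¹) ^ ν))⁻¹
        * (2 * (1 - Real.exp (-((κc - (κ + κ₁ * ((2 ^ ν : ℕ) / (2 * (M₀ : ℝ))))) / ν)))⁻¹) ^ ν
        * (2 * (2 : ℝ) ^ ν / ((M₀ : ℝ) / (4 * ν))
          * ((Real.exp 1 * (κp - (κ + κ₁ * ((2 ^ ν : ℕ) / (2 * (M₀ : ℝ))))))⁻¹ * (X * ρ₀))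
          + (2 : ℝ) ^ ν * Real.exp (-(κ₂ * m₀)) * (X * ρ₀)) < 1)
    {x : ℝ} (hx0 : 0 ≤ x) (hxX : x ≤ X) (Δ₀ : Fin ν → ℤ) :
    termSum (decFamilyΩ (tcellAt Md e) (ETor M₀ e) (tdomOf Md e cellsOf) (hTor M₀ e) (pieceK Rm Rmᵀ G (x : ℂ)) near
      (fun b => locInv (Knear (pieceK Rm Rmᵀ G (x : ℂ)) near b) (ETor M₀ e) b) (fun _ => (1 : ℂ)) Δ₀) 1
      = (1 + (x : ℂ) • (Rm * Ktot G * Rmᵀ))⁻¹ := by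
  have hx : ‖(x : ℂ)‖ ≤ X := by rw [Complex.norm_real, Real.norm_of_nonneg hx0]; exact hxX
  rw [← Ktot_pieceK]
  exact termSum_torus_end hν hM₀ hdiv h2N hMd hdivd e he hκ hκ₁ hκ₂ (pieceK Rm Rmᵀ G (x : ℂ)) cellsOf
    (tcells_pieceK Md e Rm G cellsOf hKcells₀ (x : ℂ)) near hnear hκc hκcp
    (rowBound_pieceK Rm G cellsOf hx hT₀) (colBound_pieceK Rm G cellsOf hx hTc₀)
    (reCoercive_one_add_tilt Rm hR G hpsd hx0) hm hρ Δ₀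

end Torus

/-! ## §5 Non-vacuity -/

/-- **NON-VACUITY ON THE TORUS**: one site mapped to the origin of the circle `ℤ∕8` (`ν = 1`, `N ≡ 8`, `M₀ = 1`, `M_d = 8`:
`1 ∣ 8`, `2·1 ≤ 8`, `8·1 ≤ 8`, `8 ∣ 8`), zero pieces with empty cell budgets, `near ≡ univ`, `κ = 0`, `κ₁ = 1`, `κ₂ = 0`,
`κ⁺ = 2`, `κ_c = 3∕2`, `ρ = ρ_c = 0`, `m₀ = 0`, `γ = 1`: the hypotheses of `termSum_torus_end` are jointly satisfiable and the END
reads `termSum … 1 = (1 + 0)⁻¹` with the CONSTRUCTED local inverses. [folklore] -/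
example : termSum (decFamilyΩ (tcellAt 8 (fun _ : Fin 1 => (UT.ofSite (fun _ : Fin 1 => 8) fun _ => 0)))
      (ETor 1 fun _ : Fin 1 => (UT.ofSite (fun _ : Fin 1 => 8) fun _ => 0))
      (tdomOf 8 (fun _ : Fin 1 => (UT.ofSite (fun _ : Fin 1 => 8) fun _ => 0)) (fun _ : Fin 1 => (∅ : Finset (Fin 1 → ℤ))))
      (hTor 1 fun _ : Fin 1 => (UT.ofSite (fun _ : Fin 1 => 8) fun _ => 0)) (fun _ : Fin 1 => (0 : Matrix (Fin 1) (Fin 1) ℂ))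
      (fun _ => (Finset.univ : Finset (Fin 1)))
      (fun b => locInv (Knear (fun _ : Fin 1 => (0 : Matrix (Fin 1) (Fin 1) ℂ)) (fun _ => Finset.univ) b)
        (ETor 1 fun _ : Fin 1 => (UT.ofSite (fun _ : Fin 1 => 8) fun _ => 0)) b) (fun _ => (1 : ℂ)) 0) 1
    = (1 + Ktot (fun _ : Fin 1 => (0 : Matrix (Fin 1) (Fin 1) ℂ)))⁻¹ := by
  have hsd : ∀ i j : Fin 1, tdistOn (fun _ : Fin 1 => (UT.ofSite (fun _ : Fin 1 => 8) fun _ => (0 : Fin 8))) i j = 0 :=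
    fun i j => dist_self _
  refine termSum_torus_end (ν := 1) (N := fun _ : Fin 1 => 8) one_pos (M₀ := 1) (Md := 8) le_rfl (fun _ => one_dvd _)
    (fun _ => by norm_num) (by norm_num) (fun _ => dvd_rfl) (fun _ : Fin 1 => (UT.ofSite (fun _ : Fin 1 => 8) fun _ => 0))
    (fun a b _ => Subsingleton.elim a b) (κ := 0) (κ₁ := 1) (κ₂ := 0) (κp := 2) (ρ := 0) (ρc := 0) (m₀ := 0) (γ := 1)
    (κc := 3 / 2) le_rfl one_pos le_rfl (fun _ : Fin 1 => (0 : Matrix (Fin 1) (Fin 1) ℂ)) (fun _ => ∅)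
    (fun ω k l hk => by simp at hk) (fun _ => Finset.univ) (fun b ω hω => absurd (Finset.mem_univ ω) hω) (by norm_num)
    (by norm_num) (fun k => by simp [pieceMaj]) (fun l => by simp [pieceMaj]) (fun z => ?_) (by norm_num) (by norm_num) 0
  have hK : Ktot (fun _ : Fin 1 => (0 : Matrix (Fin 1) (Fin 1) ℂ)) = 0 := by simp [Ktot]
  have hform : star z ⬝ᵥ ((1 : Matrix (Fin 1) (Fin 1) ℂ) *ᵥ z) = ((nsq z : ℝ) : ℂ) := by
    rw [← AccretiveCombesThomas.conjForm_zero_rate 1 (fun _ => (0 : ℝ)) z,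
      UnitLatticeWalkInversionDecay.conjForm_one]
  rw [hK, add_zero, hform, Complex.ofReal_re, one_mul]

end

end Summit.QuantumFields.BalabanUV.Beta.UnitLatticeOmegaTorus
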